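import Literature.MathematicalPhysics.QuantumFieldTheory.Balaban1983to89.B11Prop7Model
import Literature.MathematicalPhysics.QuantumFieldTheory.Balaban1983to89.B11Prop7Assembly

/-!
# `Balaban1983to89.B11Prop7ModelBridge` — T. Bałaban, *The variational problem and background fields in renormalization group method
# for lattice gauge theories*, Commun. Math. Phys. **102** (1985) 277–309 [Balaban1985Variational], **Proposition 7** (p. 299):
# the ASSEMBLY `B11Prop7Assembly` (Prop. 7 ⇐ Props 2, 5, 6 by name, modulo the bridge laws and the located leaves of pp. 296–299)
# INSTANTIATED on the one-norm linearized chart model of `B11Prop7Model` — every hypothesis structure of the assembly (`Bridge.Laws`,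
# `ExistenceLeavesCap`, and the typed `B11.Prop2Printed`, `Prop5Printed`, `Prop6Printed` it consumes) is a THEOREM of the model, and
# `B11.Prop7Printed` for the model family is obtained a second time, through `prop7Printed_of_props_cap` (consistency certificate of the
# kernel-assembled proof DAG of row B11.Prop7; kind «model-instance»)

statement-level skeleton of published theorems with citation tags; proofs where landed; nothing here is a claim about the Yang–Mills mass gap

PDF held: `paper:balaban1985-cmp102-variational-background` (journal page = PDF page + 276); pp. 280–281, 294–299 [PDF 4–5, 18–23] as read for
`B11Prop7Assembly` / `B11Prop7Model` by this seat.

CITATION HEADER (lean-in-tree rule 2026-08-18).  WHAT IS REPRODUCED: SKELETON row `B11.Prop7` (decl of record `B11.Prop7Printed B₃ C₁ fam`);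
the assembly `B11Prop7Assembly.prop7Printed_of_props_cap` (p255102 + v1.1: clause (i) p. 296 «by Propositions 5 and 6 … (122)», clause (ii)
p. 296 «Equation (111) has a solution … This solution determines a critical configuration U₁ by the transformation (112)» + p. 299 «we apply
to it a gauge transformation u … U_k = (U₁U₀)^u … Hence A′ = 0 is a minimum») and the model `B11Prop7Model.ChartDatum` (Prop. 7's content
proved directly).  THIS FILE checks the two against each other: §1 the Sect. A–E carrier `B11.LGData` of a chart datum (`lgData`; readings
(M1)–(M4) of `B11Prop5Model` — backgrounds indexed by the boundary datum V they are constructed from (Sect. A (12)–(14)), (14) read as U₀ = U₀(V)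
∧ (28) ∧ (103), (18) = (6) in the chart, (19)–(21) = ‖A′‖ < 2ε₂ ∧ (75)–(76), (111) literally, (112) = A₁ + H₁b, «arbitrary 𝔄 with the bounds of
H₁B» = ‖𝔄‖ < 2dLB₀C₁ε₁; analyticity in 𝔄 NOT modelled in the real chart — `SolAnalytic` inert, see `B11Prop6Model` for the complex scheme)
and the bridge `bridge` ((15): U = U′U₀ read as the chart point itself); §2 the typed Propositions 2, 5, 6 PROVED for this carrier:
`prop2Printed_lg` (Prop. 2 is the identity in a gauge slice: u = 1, U₁ = U′; needs 2B₁ ≥ 1), `prop5Printed_lg` (Sect. D chain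
`B11Prop7Model.ChartDatum.crit_iff_fixed`; needs B₀B₃ ≤ 3B₁ for (104)), `prop6Printed_lg` (the real scheme (116)–(121):
`B11Prop7Model.existsUnique_fixed` at ε₄ and at 2B₀C₁B₃ε₁ (nested balls, «ε₄ = 3B₀C₁B₃ε₁»), strict (115) `norm_lt_of_fixed`; a₄ = min{a₃/4,
(16B₀C₄)⁻¹} by `B11.ineq118_121`); §3 the assembly's hypothesis structures PROVED: `bridge_laws : (bridge Dt C₁).Laws C₁ B₃`,
**`leavesCap : ExistenceLeavesCap (bridge Dt C₁) B₀ B₃ C₁ (3B₀) 2 (min{a₃/2, γ/(8C₄)})`** (crit112 ⇐ `crit_iff_fixed`; axial18 with u = 1;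
minimal142 with the cap ⇐ `isMinOn_of_crit_of_small` = `B11Eq142LocalMin.isMinOn_of_critical` on 𝔘(e), 2e ≤ a₃, 8C₄e ≤ γ), `sat14_of_reg7`
(the Sect. A law «V with (7) ⇒ U₀ with (14)» in the model: U₀ := U₀(V)); §4 **`prop7Printed_via_assembly : B11.Prop7Printed B₃ C₁ (fun i =>
(δ i).toVarProblemX C₁)`** := `B11Prop7Assembly.prop7Printed_of_props_cap` with B₁ = B₀B₃ + 1, c₁ = 1, O₁ = 3B₀, O₂ = 2, e₅ = min{a₃/2,
γ/(8C₄)} — the same statement as `B11Prop7Model.prop7Printed_model`, reached through the paper's proposition DAG; `thm1Printed_via_assembly`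
(⇐ typed Prop. 8 and Sect. F for the family, NOT claimed).
HONEST SCOPE.  As `B11Prop7Model`: nothing of the lattice; the analytic inputs are data of the index; «absolute constants» (d, L)-dependent.
The uncapped leaf `ExistenceLeaves.minimal142` of p255102 is NOT provable for the model (critical points outside 𝔘(e₅) need not be minima) —
whence the v1.1 cap.  Mega-formalization `lit-balaban`, HOME `run/shared/lean/pub/lit-balaban/`, reader/typer seat r08 gen 7 (unit
`lit-balaban-r08`).  Imports `B11Prop7Model`, `B11Prop7Assembly`; modifies nothing.  Net new unproved facts: 0.
-/

noncomputable section

open scoped InnerProductSpace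
open Set Metric Filter Topology

namespace Literature.MathematicalPhysics.QuantumFieldTheory.Balaban1983to89.B11Prop7ModelBridge

open B11
open B11Eq81Expansion (IsCritical82 tangent83 mem_tangent83_iff)
open B11Prop7Model (mapT116 eq111_iff_fixed mapsTo_118 lipschitz_120 existsUnique_fixed ChartDatum)
open B11Prop7Assembly (Bridge ExistenceLeavesCap prop7Printed_of_props_cap thm1Printed_of_props_cap)
open B11Eq142LocalMin (isMinOn_of_critical)

variable {E F S Bdry : Type} [NormedAddCommGroup E] [InnerProductSpace ℝ E] [NormedAddCommGroup F]
  [InnerProductSpace ℝ F] [AddCommGroup S] [Module ℝ S] {B₀ C₄ a₃ γ B₃ : ℝ}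
  (Dt : ChartDatum E F S Bdry B₀ C₄ a₃ γ B₃)

/-! ## §1 The Sect. A–E carrier of a chart datum and the bridge -/

/-- **The `B11.LGData` carrier of a chart datum**: backgrounds `Cfg := Bdry` — U₀ = U₀(V) is indexed by the boundary datum it is built from
(Sect. A (12)–(14)), and every field reads its operators and its block datum b at the index U₀; `Pert := Fld := E`; `Sat14 a b V U₀ := U₀ = V ∧
‖J‖ ≤ a ∧ ‖H₁b‖ < 2dLB₀·b` ((14) ⇒ (28), (103)); `In18 ε₀ V U₀ A′ := ‖A′‖ < ε₀ ∧ A′ ∈ K_{U₀}` ((18) = (6) in the gauge slice); `Crit`/`CritL` :=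
(82) at U₀; `In19_21 ε₂ V U₀ A′ := ‖A′‖ < 2ε₂ ∧ Q_{U₀}A′ = b(U₀) ∧ RD*A′ = 0`; `toAxial _ U₁ _ := U₁`; `nMax := ‖·‖`; `Sol111` = (111) literally,
`Sol111G` the same with 𝔄, `T112 V U₀ A₁ := A₁ + H₁b`, `LikeH1B ε₁ U₀ 𝔄 := ‖𝔄‖ < 2dLB₀C₁ε₁`; `SolAnalytic` and the Sect. C/F/G fields inert. [cite: Balaban1985Variational, (14)–(21) pp.279–281, (82) p.290, (103)–(104) p.293, (111)–(112) p.294, (115) p.294] -/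
def lgData (C₁ : ℝ) : B11.LGData where
  Cfg := Bdry
  Bdry := Bdry
  Pert := E
  GT := PUnit
  Fld := E
  Cell := PUnit
  Site := PUnit
  L := Dt.L
  eta := 1
  dim := Dt.dim
  scale := fun _ => 0
  cscale := fun _ => 0
  dist := fun _ _ => 0
  Sat14 := fun a b V U₀ => U₀ = V ∧ ‖(Dt.ops U₀).J‖ ≤ a ∧
    ‖(Dt.ops U₀).H₁ (Dt.bdat U₀)‖ < 2 * ((Dt.dim : ℝ) * Dt.L) * B₀ * b
  In18 := fun ε₀ _ U₀ A => ‖A‖ < ε₀ ∧ A ∈ Dt.Kset U₀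
  Crit := fun _ U₀ A => Dt.Crit U₀ A
  In19_21 := fun ε₂ _ U₀ A => ‖A‖ < 2 * ε₂ ∧ (Dt.ops U₀).Q A = Dt.bdat U₀ ∧ (Dt.ops U₀).R ((Dt.ops U₀).Dstar A) = 0
  CritL := fun _ U₀ A => Dt.Crit U₀ A
  Restricted := fun _ _ => True
  toAxial := fun _ U₁ _ => U₁
  In43 := fun _ ε A => ‖A‖ < ε
  nM1 := fun _ A => ‖A‖
  Def47 := fun _ _ => True
  T47 := fun _ A => A
  normD := fun _ _ => 0
  kerD := fun _ _ _ _ => 0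
  nMax := fun _ A => ‖A‖
  dVn := fun U₀ A => ‖(Dt.ops U₀).gradV A‖
  dVAnalytic := fun _ _ => True
  Sol111 := fun _ U₀ A₁ => A₁ + ((Dt.ops U₀).G₁ ∘ₗ (Dt.ops U₀).Padj) (Dt.ops U₀).J +
    ((Dt.ops U₀).G₁ ∘ₗ (Dt.ops U₀).Padj) ((Dt.ops U₀).gradV (A₁ + (Dt.ops U₀).H₁ (Dt.bdat U₀))) = 0
  T112 := fun _ U₀ A₁ => A₁ + (Dt.ops U₀).H₁ (Dt.bdat U₀)
  LikeH1B := fun ε₁ _ 𝔄 => ‖𝔄‖ < 2 * ((Dt.dim : ℝ) * Dt.L) * B₀ * C₁ * ε₁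
  Sol111G := fun U₀ 𝔄 A₁ => A₁ + ((Dt.ops U₀).G₁ ∘ₗ (Dt.ops U₀).Padj) (Dt.ops U₀).J +
    ((Dt.ops U₀).G₁ ∘ₗ (Dt.ops U₀).Padj) ((Dt.ops U₀).gradV (A₁ + 𝔄)) = 0
  SolAnalytic := fun _ _ _ => True

/-- **The bridge (15)** between the Theorem-1 carrier of the chart datum and its Sect. A–E carrier: the boundary datum is the same, and a
configuration «U = U′U₀» is read as the chart point U′ itself. [cite: Balaban1985Variational, (15) p.280] -/
def bridge (C₁ : ℝ) : Bridge (Dt.toVarProblemX C₁) (lgData Dt C₁) where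
  bdry := fun V => V
  emb := fun _ U' => U'

/-! ## §2 The typed Propositions 2, 5, 6 for the carrier -/

/-- **Proposition 2 for the carrier** — in a gauge slice the passage (18) → (19)–(21) → axial gauge is the identity (u = 1, U₁ = U′): for
2B₁ ≥ 1 (so that ‖U′‖ < ε₀ ≤ 2ε₂ under B₁(ε₀ + C₁ε₁) ≤ ε₂) and C₁ ≥ 0, `B11.Prop2Printed B₁ B₃ C₁ c₁` holds for every c₁.
[cite: Balaban1985Variational, Prop. 2 p.281, (16)–(18) p.280] -/
theorem prop2Printed_lg {B₁ C₁ : ℝ} (hB₁ : 1 ≤ 2 * B₁) (hC₁ : 0 ≤ C₁) (c₁ : ℝ) {I : Type}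
    {Ef Ff Sf Bdryf : I → Type} [∀ i, NormedAddCommGroup (Ef i)] [∀ i, InnerProductSpace ℝ (Ef i)]
    [∀ i, NormedAddCommGroup (Ff i)] [∀ i, InnerProductSpace ℝ (Ff i)] [∀ i, AddCommGroup (Sf i)] [∀ i, Module ℝ (Sf i)]
    (δ : ∀ i, ChartDatum (Ef i) (Ff i) (Sf i) (Bdryf i) B₀ C₄ a₃ γ B₃) :
    B11.Prop2Printed B₁ B₃ C₁ c₁ (fun i => lgData (δ i) C₁) := by
  intro i ε₀ ε₁ ε₂ _ hε₁ _ hε₂ V U₀ _ U' h18 hcrit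
  change Ef i at U'
  dsimp only [lgData] at h18 hcrit ⊢
  obtain ⟨hU', hQ, hR⟩ := h18
  refine ⟨PUnit.unit, U', trivial, ⟨?_, hQ, hR⟩, hcrit, rfl⟩
  have h0 : 0 ≤ ε₀ + C₁ * ε₁ := by
    have := mul_nonneg hC₁ hε₁.le
    linarith [norm_nonneg U']
  have key : 1 * (ε₀ + C₁ * ε₁) ≤ 2 * B₁ * (ε₀ + C₁ * ε₁) := mul_le_mul_of_nonneg_right hB₁ h0
  have := mul_nonneg hC₁ hε₁.le
  linarith

/-- **Proposition 5 for the carrier** — the Sect. D chain (82) ⇒ (111) (`B11Prop7Model.ChartDatum.crit_iff_fixed` + `eq111_iff_fixed`) and the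
arithmetic of (103)–(104): ‖A₁‖ ≤ ‖A′‖ + ‖H₁b‖ < 2ε₂ + 2dLB₀C₁ε₁ ≤ 2ε₂ + 2B₀B₃ε₂/B₁ ≤ 8ε₂ ≤ 2ε₃ for B₀B₃ ≤ 3B₁ (dL ≤ B₃, B₁C₁ε₁ ≤ ε₂).
[cite: Balaban1985Variational, Prop. 5 (111)–(112) p.294, (103)–(104) p.293] -/
theorem prop5Printed_lg {B₁ C₁ : ℝ} (hB₀ : 0 ≤ B₀) (hB₁ : 0 < B₁) (hB₀B₁ : B₀ * B₃ ≤ 3 * B₁) (hC₁ : 0 ≤ C₁) {I : Type}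
    {Ef Ff Sf Bdryf : I → Type} [∀ i, NormedAddCommGroup (Ef i)] [∀ i, InnerProductSpace ℝ (Ef i)]
    [∀ i, NormedAddCommGroup (Ff i)] [∀ i, InnerProductSpace ℝ (Ff i)] [∀ i, AddCommGroup (Sf i)] [∀ i, Module ℝ (Sf i)]
    (δ : ∀ i, ChartDatum (Ef i) (Ff i) (Sf i) (Bdryf i) B₀ C₄ a₃ γ B₃) :
    B11.Prop5Printed B₁ B₃ C₁ (fun i => lgData (δ i) C₁) := by
  refine ⟨1, one_pos, ?_⟩
  intro i ε₀ ε₁ ε₂ ε₃ hε₁ h0 h1 h2 _ V U₀ h14 A' h19 hcrit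
  change Ef i at A'
  dsimp only [lgData] at h14 h19 hcrit ⊢
  obtain ⟨-, -, hH⟩ := h14
  obtain ⟨hA', hQA, hRA⟩ := h19
  have hdL : 0 ≤ (((δ i).dim : ℝ) * (δ i).L) := mul_nonneg (Nat.cast_nonneg _) (δ i).L_nonneg
  have hB₃ : 0 ≤ B₃ := le_trans hdL (δ i).dL_le
  have hε₀ : 0 ≤ ε₀ := le_trans (mul_nonneg hB₃ hε₁.le) h0
  have hε₂ : 0 ≤ ε₂ := by linarith [norm_nonneg A', hA']
  -- (103): ‖H₁b‖ < 2dLB₀C₁ε₁ ≤ 2B₀B₃C₁ε₁ ≤ 2B₀B₃ε₂/B₁ ≤ 6ε₂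
  have hC₁ε₁ : C₁ * ε₁ ≤ ε₂ / B₁ := by
    rw [le_div_iff₀ hB₁]; nlinarith
  have ha : 2 * (((δ i).dim : ℝ) * (δ i).L) * B₀ * (C₁ * ε₁) ≤ 6 * ε₂ := by
    have e1 : 2 * (((δ i).dim : ℝ) * (δ i).L) * B₀ * (C₁ * ε₁) ≤ 2 * B₃ * B₀ * (C₁ * ε₁) := by
      have := mul_le_mul_of_nonneg_left (δ i).dL_le (by positivity : (0 : ℝ) ≤ 2 * B₀ * (C₁ * ε₁))
      linarith
    have e2 : 2 * B₃ * B₀ * (C₁ * ε₁) ≤ 2 * B₃ * B₀ * (ε₂ / B₁) :=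
      mul_le_mul_of_nonneg_left hC₁ε₁ (by positivity)
    have e3 : 2 * B₃ * B₀ * (ε₂ / B₁) ≤ 6 * ε₂ := by
      rw [show 2 * B₃ * B₀ * (ε₂ / B₁) = B₀ * B₃ / B₁ * (2 * ε₂) by ring]
      have hq : B₀ * B₃ / B₁ ≤ 3 := by rw [div_le_iff₀ hB₁]; linarith
      nlinarith
    linarith
  have hK : A' ∈ (δ i).Kset U₀ := ⟨hQA, hRA⟩
  refine ⟨A' - ((δ i).ops U₀).H₁ ((δ i).bdat U₀), ?_, ?_, sub_add_cancel _ _⟩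
  · calc ‖A' - ((δ i).ops U₀).H₁ ((δ i).bdat U₀)‖ ≤ ‖A'‖ + ‖((δ i).ops U₀).H₁ ((δ i).bdat U₀)‖ := norm_sub_le _ _
      _ < 2 * ε₂ + 6 * ε₂ := add_lt_add_of_lt_of_le hA' (hH.le.trans ha)
      _ ≤ 2 * ε₃ := by linarith
  · have hfix := ((δ i).crit_iff_fixed U₀ hK).1 hcrit
    exact (eq111_iff_fixed _ _ _ _ _).2 hfix

/-- **(117) and the strict (115)**: a fixed point X of (116) with ‖X‖ ≤ ε₄ has ‖X‖ < ε₄, since ‖X‖ = ‖TX‖ ≤ B₀‖J‖ + B₀C₄‖X + 𝔄‖² <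
B₀j + B₀C₄(ε₄ + a)² ≤ ε₄ (‖𝔄‖ < a strict, B₀C₄ > 0). [cite: Balaban1985Variational, (115)–(118) pp.294–295] -/
theorem norm_lt_of_fixed {𝔊 : E →ₗ[ℝ] E} {W : E → E} (h𝔊 : ∀ f, ‖𝔊 f‖ ≤ B₀ * ‖f‖) (hB₀ : 0 < B₀) (hC₄ : 0 < C₄)
    (hquad : ∀ z : E, ‖z‖ < a₃ → ‖W z‖ ≤ C₄ * ‖z‖ ^ 2) {J 𝔄 X : E} {j a ε₄ : ℝ} (hJ : ‖J‖ ≤ j) (h𝔄 : ‖𝔄‖ < a)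
    (hdom : ε₄ + a ≤ a₃) (hself : B₀ * j + B₀ * C₄ * (ε₄ + a) ^ 2 ≤ ε₄) (hX : ‖X‖ ≤ ε₄)
    (hfix : mapT116 𝔊 W J 𝔄 X = X) : ‖X‖ < ε₄ := by
  have harg : ‖X + 𝔄‖ < ε₄ + a := (norm_add_le X 𝔄).trans_lt (by linarith)
  have h0 : 0 ≤ ‖X + 𝔄‖ := norm_nonneg _
  have hsq : ‖X + 𝔄‖ ^ 2 < (ε₄ + a) ^ 2 := by nlinarith
  have h1 : ‖𝔊 J‖ ≤ B₀ * j := (h𝔊 J).trans (mul_le_mul_of_nonneg_left hJ hB₀.le)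
  have h2 : ‖𝔊 (W (X + 𝔄))‖ < B₀ * C₄ * (ε₄ + a) ^ 2 := by
    calc ‖𝔊 (W (X + 𝔄))‖ ≤ B₀ * ‖W (X + 𝔄)‖ := h𝔊 _
      _ ≤ B₀ * (C₄ * ‖X + 𝔄‖ ^ 2) := mul_le_mul_of_nonneg_left (hquad _ (harg.trans_le hdom)) hB₀.le
      _ < B₀ * (C₄ * (ε₄ + a) ^ 2) := mul_lt_mul_of_pos_left (mul_lt_mul_of_pos_left hsq hC₄) hB₀
      _ = B₀ * C₄ * (ε₄ + a) ^ 2 := by ring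
  calc ‖X‖ = ‖mapT116 𝔊 W J 𝔄 X‖ := by rw [hfix]
    _ = ‖-𝔊 J - 𝔊 (W (X + 𝔄))‖ := rfl
    _ ≤ ‖-𝔊 J‖ + ‖𝔊 (W (X + 𝔄))‖ := norm_sub_le _ _
    _ = ‖𝔊 J‖ + ‖𝔊 (W (X + 𝔄))‖ := by rw [norm_neg]
    _ < B₀ * j + B₀ * C₄ * (ε₄ + a) ^ 2 := by linarith
    _ ≤ ε₄ := hself

/-- **The Sect. E conclusion over a real Banach space, for one datum 𝔄** (= H₁b, or «an arbitrary configuration 𝔄 … satisfying the same bounds»):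
under 4ε₄ ≤ a₃, 16B₀C₄ε₄ ≤ 1 (ε₄ ≤ a₄), 2B₀C₁B₃ε₁ ≤ ε₄, dL ≤ B₃, ‖J‖ ≤ C₁B₃ε₁ ((28)) and ‖𝔄‖ < 2dLB₀C₁ε₁ ((103)), Eq. (111) with datum 𝔄 has a
solution in the OPEN ball (115), of norm < 3B₀C₁B₃ε₁ (nested balls: the solution in the ball of radius 2B₀C₁B₃ε₁ is the one in the ball ε₄), and
every solution in the open ball equals it (`B11Prop7Model.existsUnique_fixed`, `B11.ineq118_121`). [cite: Balaban1985Variational, Prop. 6 p.295] -/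
theorem exists_solution_real [CompleteSpace E] {𝔊 : E →ₗ[ℝ] E} {W : E → E} (h𝔊 : ∀ f, ‖𝔊 f‖ ≤ B₀ * ‖f‖)
    (hquad : ∀ z : E, ‖z‖ < a₃ → ‖W z‖ ≤ C₄ * ‖z‖ ^ 2)
    (hlip : ∀ m : ℝ, 2 * m ≤ a₃ → ∀ z z' : E, ‖z‖ < m → ‖z'‖ < m → ‖W z - W z'‖ ≤ 4 * C₄ * m * ‖z - z'‖)
    (hB₀ : 0 < B₀) (hC₄ : 0 < C₄) {dL C₁ B₃' ε₁ ε₄ : ℝ} (hdL : 0 ≤ dL) (hC₁ : 0 < C₁) (hB₃ : 0 < B₃')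
    (hε₁ : 0 < ε₁) (hdLB₃ : dL ≤ B₃') (h1 : 2 * B₀ * C₁ * B₃' * ε₁ ≤ ε₄) (h2 : 4 * ε₄ ≤ a₃)
    (h3 : 16 * B₀ * C₄ * ε₄ ≤ 1) {J : E} (hJ : ‖J‖ ≤ C₁ * B₃' * ε₁) {𝔄 : E} (h𝔄 : ‖𝔄‖ < 2 * dL * B₀ * C₁ * ε₁) :
    ∃ A₁ : E, ‖A₁‖ < ε₄ ∧ A₁ + 𝔊 J + 𝔊 (W (A₁ + 𝔄)) = 0 ∧ ‖A₁‖ < 3 * B₀ * C₁ * B₃' * ε₁ ∧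
      ∀ A₁' : E, ‖A₁'‖ < ε₄ → A₁' + 𝔊 J + 𝔊 (W (A₁' + 𝔄)) = 0 → A₁' = A₁ := by
  have hε₄ : 0 ≤ ε₄ := le_trans (by positivity) h1
  -- (118), (121) at ε₄ and at ρ₀ = 2B₀C₁B₃ε₁
  obtain ⟨⟨hdom1, h118⟩, hdom2, h121⟩ :=
    B11.ineq118_121 dL B₀ C₁ C₄ B₃' a₃ ε₁ ε₄ hdL hB₀.le hC₁.le hC₄.le hε₁.le hε₄ hdLB₃ h1 h2 h3
  have hρ₀ : 0 ≤ 2 * B₀ * C₁ * B₃' * ε₁ := by positivity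
  obtain ⟨⟨-, h118'⟩, hdom2', h121'⟩ :=
    B11.ineq118_121 dL B₀ C₁ C₄ B₃' a₃ ε₁ (2 * B₀ * C₁ * B₃' * ε₁) hdL hB₀.le hC₁.le hC₄.le hε₁.le hρ₀ hdLB₃ le_rfl
      (by linarith) (by have := mul_le_mul_of_nonneg_left h1 (by positivity : (0 : ℝ) ≤ 16 * B₀ * C₄); linarith)
  have hself : B₀ * (C₁ * B₃' * ε₁) + B₀ * C₄ * (ε₄ + 2 * dL * B₀ * C₁ * ε₁) ^ 2 ≤ ε₄ := by linarith
  have hself' : B₀ * (C₁ * B₃' * ε₁) + B₀ * C₄ * (2 * B₀ * C₁ * B₃' * ε₁ + 2 * dL * B₀ * C₁ * ε₁) ^ 2 ≤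
      2 * B₀ * C₁ * B₃' * ε₁ := by linarith
  obtain ⟨X, ⟨hXn, hXfix⟩, huniq⟩ := existsUnique_fixed (J := J) h𝔊 hB₀.le hC₄.le hquad hlip hJ h𝔄 hε₄
    (by linarith) hself (by linarith)
  obtain ⟨X₀, ⟨hX₀n, hX₀fix⟩, -⟩ := existsUnique_fixed (J := J) h𝔊 hB₀.le hC₄.le hquad hlip hJ h𝔄 hρ₀
    (by linarith) hself' (by linarith)
  have hXX₀ : X₀ = X := huniq X₀ ⟨hX₀n.trans h1, hX₀fix⟩
  have hXlt : ‖X‖ < ε₄ := norm_lt_of_fixed h𝔊 hB₀ hC₄ hquad hJ h𝔄 hdom1 hself hXn hXfix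
  refine ⟨X, hXlt, (eq111_iff_fixed 𝔊 W J 𝔄 X).2 hXfix, ?_, fun A₁' hA₁' hsol => ?_⟩
  · rw [← hXX₀]
    have : 2 * B₀ * C₁ * B₃' * ε₁ < 3 * B₀ * C₁ * B₃' * ε₁ := by
      have : 0 < B₀ * C₁ * B₃' * ε₁ := by positivity
      linarith
    exact hX₀n.trans_lt this
  · exact huniq A₁' ⟨hA₁'.le, (eq111_iff_fixed 𝔊 W J 𝔄 A₁').1 hsol⟩

/-- **Proposition 6 for the carrier** with Prop. 6's a₄ = min{a₃/4, (16B₀C₄)⁻¹}: clauses (i) and (ii) by `exists_solution_real` (𝔄 = H₁b resp.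
arbitrary with the bounds (103)); clause (iii) «analytic function of 𝔄» is NOT modelled in the real chart (inert).
[cite: Balaban1985Variational, Prop. 6 pp.295–296] -/
theorem prop6Printed_lg {C₁ : ℝ} (hB₀ : 0 < B₀) (hC₄ : 0 < C₄) (ha₃ : 0 < a₃) (hB₃ : 0 < B₃) (hC₁ : 0 < C₁) {I : Type}
    {Ef Ff Sf Bdryf : I → Type} [∀ i, NormedAddCommGroup (Ef i)] [∀ i, InnerProductSpace ℝ (Ef i)] [∀ i, CompleteSpace (Ef i)]
    [∀ i, NormedAddCommGroup (Ff i)] [∀ i, InnerProductSpace ℝ (Ff i)] [∀ i, AddCommGroup (Sf i)] [∀ i, Module ℝ (Sf i)]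
    (δ : ∀ i, ChartDatum (Ef i) (Ff i) (Sf i) (Bdryf i) B₀ C₄ a₃ γ B₃) :
    B11.Prop6Printed B₀ B₃ C₁ (fun i => lgData (δ i) C₁) := by
  refine ⟨min (a₃ / 4) (1 / (16 * B₀ * C₄)), lt_min (by positivity) (by positivity), ?_⟩
  intro i ε₁ ε₄ hε₁ hε₄a h1 V U₀ h14
  dsimp only [lgData] at h14 ⊢
  obtain ⟨-, hJ, hH⟩ := h14
  have h2 : 4 * ε₄ ≤ a₃ := by
    have := (le_div_iff₀ (by norm_num : (0 : ℝ) < 4)).1 (hε₄a.trans (min_le_left _ _))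
    linarith
  have h3 : 16 * B₀ * C₄ * ε₄ ≤ 1 := by
    have := (le_div_iff₀ (by positivity : (0 : ℝ) < 16 * B₀ * C₄)).1 (hε₄a.trans (min_le_right _ _))
    linarith
  have hdL : 0 ≤ (((δ i).dim : ℝ) * (δ i).L) := mul_nonneg (Nat.cast_nonneg _) (δ i).L_nonneg
  have hH' : ‖((δ i).ops U₀).H₁ ((δ i).bdat U₀)‖ < 2 * (((δ i).dim : ℝ) * (δ i).L) * B₀ * C₁ * ε₁ := by
    have : 2 * (((δ i).dim : ℝ) * (δ i).L) * B₀ * (C₁ * ε₁) = 2 * (((δ i).dim : ℝ) * (δ i).L) * B₀ * C₁ * ε₁ := by ring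
    rw [← this]; exact hH
  refine ⟨?_, ?_, trivial⟩
  · obtain ⟨A₁, hA, hsol, hA3, huniq⟩ := exists_solution_real ((δ i).norm_G U₀) ((δ i).quad98 U₀) ((δ i).lip120 U₀) hB₀ hC₄
      hdL hC₁ hB₃ hε₁ (δ i).dL_le h1 h2 h3 hJ hH'
    exact ⟨A₁, hA, hsol, hA3, huniq⟩
  · intro 𝔄 h𝔄
    change Ef i at 𝔄
    obtain ⟨A₁, hA, hsol, -, huniq⟩ := exists_solution_real ((δ i).norm_G U₀) ((δ i).quad98 U₀) ((δ i).lip120 U₀) hB₀ hC₄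
      hdL hC₁ hB₃ hε₁ (δ i).dL_le h1 h2 h3 hJ h𝔄
    exact ⟨A₁, hA, hsol, huniq⟩

/-! ## §3 The assembly's hypothesis structures proved for the model -/

/-- **The bridge laws hold**: `gaugeFix` with U′ = U (the chart IS the gauge-fixed space (18)); `orbit16` with u = u′ trivial; «one orbit» =
equality is symmetric and transitive. [cite: Balaban1985Variational, (16)–(18) p.280] -/
theorem bridge_laws (C₁ : ℝ) : (bridge Dt C₁).Laws C₁ B₃ where
  gaugeFix := by
    intro ε₀ ε₁ V U₀ U h14 hU hBU
    change E at U
    dsimp only [bridge, lgData, ChartDatum.toVarProblemX] at h14 hU hBU ⊢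
    obtain ⟨hUV, -, -⟩ := h14
    subst hUV
    exact ⟨U, ⟨hU, hBU⟩, rfl, fun hc => hc⟩
  orbit16 := fun _ _ _ _ _ _ => rfl
  symm := fun _ _ h => Eq.symm h
  trans := fun _ _ _ h h' => Eq.trans h h'

/-- **A critical configuration in a small space 𝔘(e) is the global minimum of 𝔉_V on (6) ∩ K_V** (the analytic core of the capped leaf
`minimal142`): for 2e ≤ a₃ and 8C₄e ≤ γ, an (82)-critical A⋆ ∈ K_V with ‖A⋆‖ < e minimises 𝔉_V on K_V ∩ 𝔘(e) (`B11Eq142LocalMin.isMinOn_of_critical`,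
θ = 4C₄e from (120)). [cite: Balaban1985Variational, (141)–(142) p.299, (120) p.295] -/
theorem isMinOn_of_crit_of_small (hC₄ : 0 ≤ C₄) (V : Bdry) {e : ℝ} (he : 2 * e ≤ a₃) (heγ : 8 * C₄ * e ≤ γ) {A : E}
    (hA : ‖A‖ < e) (hAK : A ∈ Dt.Kset V) (hc : Dt.Crit V A) :
    IsMinOn (Dt.frakF V) (Dt.Kset V ∩ ball 0 e) A := by
  have he0 : 0 ≤ e := le_trans (norm_nonneg _) hA.le
  have hS : Convex ℝ (ball (0 : E) e) := convex_ball _ _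
  have hKS : Dt.Kset V ∩ ball 0 e ⊆ ball 0 e := inter_subset_right
  have hVd : ∀ x ∈ ball (0 : E) e, HasFDerivWithinAt (Dt.Vfun V)
      ((fun y => innerSL ℝ ((Dt.ops V).gradV y)) x) (ball 0 e) x :=
    fun x _ => (Dt.hasGrad V x).hasFDerivWithinAt
  have hθ : (0 : ℝ) ≤ 4 * C₄ * e := by positivity
  have hγθ : 2 * (4 * C₄ * e) ≤ γ := by linarith
  have hAKb : A ∈ Dt.Kset V ∩ ball 0 e := ⟨hAK, mem_ball_zero_iff.2 hA⟩
  have hLip : ∀ x ∈ ball (0 : E) e,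
      ‖(fun y => innerSL ℝ ((Dt.ops V).gradV y)) x - (fun y => innerSL ℝ ((Dt.ops V).gradV y)) A‖ ≤ 4 * C₄ * e * ‖x - A‖ :=
    fun x hx => Dt.norm_innerSL_gradV_sub_le V he (mem_ball_zero_iff.1 hx) hA
  have hKT : ∀ A' ∈ Dt.Kset V ∩ ball 0 e, A' - A ∈ Dt.T83 V := fun A' hA' => Dt.sub_mem_T83 V hA'.1 hAK
  exact isMinOn_of_critical (Dt.act0 V) (Dt.ops V).J (Dt.symm V) hS hKS hVd hθ hγθ (Dt.coercive V) hAKb hLip hKT hc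

/-- **The located leaves of pp. 296–299 (capped form) are THEOREMS of the model**, with O₁ = 3B₀, O₂ = 2, e₅ = min{a₃/2, γ/(8C₄)}: `crit112` — a
solution A₁ of (111) with ‖A₁‖ < 3B₀C₁B₃ε₁ gives the critical configuration (112) A₁ + H₁b ∈ K_V (`crit_iff_fixed`, «Q𝔊 = 0, RD*𝔊 = 0») of norm
< 5B₀C₁B₃ε₁ < 2·(3B₀)C₁B₃ε₁; `axial18` — u = 1, «(19)–(21) with ε₂» ⇒ 𝔘(2ε₂); `minimal142` (capped) — `isMinOn_of_crit_of_small`.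
[cite: Balaban1985Variational, pp.296–299, (112) p.294, (141)–(142) p.299] -/
theorem leavesCap (hB₀ : 0 ≤ B₀) (hC₄ : 0 < C₄) {C₁ : ℝ} (hC₁ : 0 ≤ C₁) :
    ExistenceLeavesCap (bridge Dt C₁) B₀ B₃ C₁ (3 * B₀) 2 (min (a₃ / 2) (γ / (8 * C₄))) where
  crit112 := by
    intro ε₁ V U₀ A₁ hε₁ h14 hsol hA₁
    change E at A₁
    dsimp only [bridge, lgData] at h14 hsol hA₁ ⊢
    obtain ⟨-, -, hH⟩ := h14
    have hdL : 0 ≤ ((Dt.dim : ℝ) * Dt.L) := mul_nonneg (Nat.cast_nonneg _) Dt.L_nonneg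
    have hB₃ : 0 ≤ B₃ := le_trans hdL Dt.dL_le
    -- A₁ is a fixed point of (116), hence in the tangent space; so A₁ + H₁b ∈ K_{U₀} and (112) is critical (Prop. 5)
    have hfix : Dt.T116 U₀ A₁ = A₁ := (eq111_iff_fixed _ _ _ _ _).1 hsol
    have hA₁T : A₁ ∈ Dt.T83 U₀ := by
      have := Dt.T116_mem_T83 U₀ A₁
      rwa [hfix] at this
    obtain ⟨hQ₁, hR₁⟩ := (mem_tangent83_iff _ _ _ A₁).1 hA₁T
    have hX := Dt.hyps U₀
    have hAK : A₁ + (Dt.ops U₀).H₁ (Dt.bdat U₀) ∈ Dt.Kset U₀ := by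
      refine ⟨?_, ?_⟩
      · rw [map_add, hQ₁, zero_add]
        exact B11Eq129Minimizer.constraint_hOp hX.Kinv_spec _
      · rw [map_add, map_add, hR₁, zero_add]
        exact hX.landau _
    obtain ⟨hQ', hR'⟩ := (Dt.mem_Kset_iff U₀ _).1 hAK
    have hcrit : Dt.Crit U₀ (A₁ + (Dt.ops U₀).H₁ (Dt.bdat U₀)) := by
      rw [Dt.crit_iff_fixed U₀ hAK, add_sub_cancel_right]
      exact hfix
    have ha : 2 * ((Dt.dim : ℝ) * Dt.L) * B₀ * (C₁ * ε₁) ≤ 2 * B₀ * C₁ * B₃ * ε₁ := by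
      have := mul_le_mul_of_nonneg_left Dt.dL_le (by positivity : (0 : ℝ) ≤ 2 * B₀ * (C₁ * ε₁))
      linarith
    refine ⟨hcrit, ?_, hQ', hR'⟩
    calc ‖A₁ + (Dt.ops U₀).H₁ (Dt.bdat U₀)‖ ≤ ‖A₁‖ + ‖(Dt.ops U₀).H₁ (Dt.bdat U₀)‖ := norm_add_le _ _
      _ < 3 * B₀ * C₁ * B₃ * ε₁ + 2 * B₀ * C₁ * B₃ * ε₁ := add_lt_add_of_lt_of_le hA₁ (hH.le.trans ha)
      _ ≤ 2 * (3 * B₀ * C₁ * B₃ * ε₁) := by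
          have : 0 ≤ B₀ * C₁ * B₃ * ε₁ := by positivity
          linarith
  axial18 := by
    intro ε₁ ε₂ V U₀ U₁ h14 h19 hcrit
    change E at U₁
    dsimp only [bridge, lgData, ChartDatum.toVarProblemX] at h14 h19 hcrit ⊢
    obtain ⟨hUV, -, -⟩ := h14
    obtain ⟨hU₁, hQ, hR⟩ := h19
    subst hUV
    exact ⟨PUnit.unit, trivial, hU₁, ⟨hQ, hR⟩, hcrit⟩
  minimal142 := by
    intro e ε₁ V U₀ U₁ u he _ _ _ hU hBU hc
    change E at U₁
    dsimp only [bridge, lgData, ChartDatum.toVarProblemX] at hU hBU hc ⊢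
    have he2 : 2 * e ≤ a₃ := by linarith [he.trans (min_le_left _ _)]
    have heγ : 8 * C₄ * e ≤ γ := by
      have := he.trans (min_le_right _ _)
      rw [le_div_iff₀ (by positivity)] at this
      linarith
    exact ⟨hU, hBU, B11Prop7Model.ChartDatum.isLocalMinOn_of_isMinOn_inter_ball hU
      (isMinOn_of_crit_of_small Dt hC₄.le V he2 heγ hU hBU hc)⟩

/-- **The Sect. A law «V with (7) ⇒ a background U₀ with (14)»** in the model: U₀ := U₀(V), and (14) at the printed parameters is `Reg7`
((28) ∧ (103)). [cite: Balaban1985Variational, (12)–(14) p.280, (28) p.282, (103) p.293] -/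
theorem sat14_of_reg7 (C₁ ε₁ : ℝ) (V : Bdry) (hV : (Dt.toVarProblemX C₁).Reg7 ε₁ V) :
    ∃ U₀ : (lgData Dt C₁).Cfg, (lgData Dt C₁).Sat14 (C₁ * B₃ * ε₁) (C₁ * ε₁) ((bridge Dt C₁).bdry V) U₀ := by
  dsimp only [bridge, lgData, ChartDatum.toVarProblemX] at hV ⊢
  refine ⟨V, rfl, hV.1, ?_⟩
  have : 2 * ((Dt.dim : ℝ) * Dt.L) * B₀ * (C₁ * ε₁) = 2 * ((Dt.dim : ℝ) * Dt.L) * B₀ * C₁ * ε₁ := by ring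
  rw [this]; exact hV.2

/-! ## §4 Proposition 7 for the model family, through the assembly -/

section Family

variable {I : Type} (Ef Ff Sf Bdryf : I → Type) [∀ i, NormedAddCommGroup (Ef i)] [∀ i, InnerProductSpace ℝ (Ef i)]
  [∀ i, CompleteSpace (Ef i)] [∀ i, NormedAddCommGroup (Ff i)] [∀ i, InnerProductSpace ℝ (Ff i)]
  [∀ i, AddCommGroup (Sf i)] [∀ i, Module ℝ (Sf i)]

/-- **`B11.Prop7Printed B₃ C₁` for the chart-model family, THROUGH THE ASSEMBLY**: `B11Prop7Assembly.prop7Printed_of_props_cap` fed with the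
model's bridge laws, capped leaves (O₁ = 3B₀, O₂ = 2, e₅ = min{a₃/2, γ/(8C₄)}), the typed Propositions 2, 5, 6 proved for the carrier
(B₁ = B₀B₃ + 1, c₁ = 1 — so «B₁ = 5dLB₀ ⇒ B₀ ≤ 4B₁» and the (104)-condition B₀B₃ ≤ 3B₁ hold) and the Sect. A law `sat14_of_reg7`; printed facts
1 ≤ B₃ ((162)), 1 ≤ C₁ (C₁ = L³).  The same typed statement as `B11Prop7Model.prop7Printed_model`, reached through the paper's proposition DAG.
[cite: Balaban1985Variational, Prop. 7 p.299] -/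
theorem prop7Printed_via_assembly {B₀ C₄ a₃ γ B₃ C₁ : ℝ} (hB₀ : 0 < B₀) (hC₄ : 0 < C₄) (ha₃ : 0 < a₃) (hγ : 0 < γ)
    (hB₃ : 1 ≤ B₃) (hC₁ : 1 ≤ C₁) (δ : ∀ i, ChartDatum (Ef i) (Ff i) (Sf i) (Bdryf i) B₀ C₄ a₃ γ B₃) :
    B11.Prop7Printed B₃ C₁ (fun i => (δ i).toVarProblemX C₁) :=
  prop7Printed_of_props_cap (famP := fun i => (δ i).toVarProblemX C₁) (famD := fun i => lgData (δ i) C₁)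
    (fun i => bridge (δ i) C₁) (B₁ := B₀ * B₃ + 1) (c₁ := 1)
    (fun i => bridge_laws (δ i) C₁) (fun i => leavesCap (δ i) hB₀.le hC₄ (by linarith))
    hB₀ (by positivity) hB₃ hC₁ (by nlinarith) one_pos (by positivity) two_pos (lt_min (by positivity) (by positivity))
    (prop2Printed_lg (by nlinarith) (by linarith) 1 δ)
    (prop5Printed_lg hB₀.le (by positivity) (by nlinarith) (by linarith) δ)
    (prop6Printed_lg hB₀ hC₄ ha₃ (by linarith) (by linarith) δ)
    (fun i ε₁ V _ hV => sat14_of_reg7 (δ i) C₁ ε₁ V hV)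

/-- The chain one level up through the assembly: Theorem 1 (typed) for the family from the typed Proposition 8 and Sect. F statements for it
(NOT claimed) — `B11Prop7Assembly.thm1Printed_of_props_cap` with the model's `laws`. [cite: Balaban1985Variational, Thm 1 p.279] -/
theorem thm1Printed_via_assembly {B₀ C₄ a₃ γ B₃ C₁ : ℝ} (hB₀ : 0 < B₀) (hC₄ : 0 < C₄) (ha₃ : 0 < a₃) (hγ : 0 < γ)
    (hB₃ : 1 ≤ B₃) (hC₁ : 1 ≤ C₁) (δ : ∀ i, ChartDatum (Ef i) (Ff i) (Sf i) (Bdryf i) B₀ C₄ a₃ γ B₃)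
    (h8 : B11.Prop8Printed B₃ (fun i => (δ i).toVarProblemX C₁))
    (hF : B11.SectFPrinted B₃ (fun i => (δ i).toVarProblemX C₁)) :
    B11.Thm1Printed (fun i => ((δ i).toVarProblemX C₁).toVarProblem) :=
  thm1Printed_of_props_cap (famP := fun i => (δ i).toVarProblemX C₁) (famD := fun i => lgData (δ i) C₁)
    (fun i => bridge (δ i) C₁) (B₁ := B₀ * B₃ + 1) (c₁ := 1)
    (fun i => bridge_laws (δ i) C₁) (fun i => leavesCap (δ i) hB₀.le hC₄ (by linarith)) (fun i => (δ i).laws C₁)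
    hB₀ (by positivity) hB₃ hC₁ (by nlinarith) one_pos (by positivity) two_pos (lt_min (by positivity) (by positivity))
    (prop2Printed_lg (by nlinarith) (by linarith) 1 δ)
    (prop5Printed_lg hB₀.le (by positivity) (by nlinarith) (by linarith) δ)
    (prop6Printed_lg hB₀ hC₄ ha₃ (by linarith) (by linarith) δ)
    (fun i ε₁ V _ hV => sat14_of_reg7 (δ i) C₁ ε₁ V hV) h8 hF

end Family

end Literature.MathematicalPhysics.QuantumFieldTheory.Balaban1983to89.B11Prop7ModelBridge

end
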